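import Literature.MathematicalPhysics.QuantumFieldTheory.Balaban1983to89.B3Ineq211RegularTorus

/-!
# N15 (NE2⁺, row s3 KING-MODEL ∕ RIEMANN-KERNEL RUNG) — PART Ζ-a: THE TRANSPORT-FREE HÖLDER LINES (3.65) OF KING 1986 PROPOSITION 3.7
# AT A REGULAR BACKGROUND `A ≠ 0`, FROM [Ba3] (2.10)∕(2.11) — the transport is immaterial in the block-norm reading

count-neutral helper of the pub-ymgap K3⁸ programme (`--supports stmt-QuantumFields-27366`); nothing here is a claim about Bałaban's
non-abelian `G(U)`, the continuum, ℝ⁴, OS axioms, a mass gap or the Clay problem.  One finite torus `T_ε` at fixed `ε`.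

## What is printed

C. King, *The U(1) Higgs model. I. The continuum limit*, Commun. Math. Phys. **102** (1986) 649–677 [King1986], p. 663 [PDF 15]:
*"For a propagator G(x, y), we define a "Hölder derivative" by (∂_α(x, y)G)(z) = |x − y|^{−α}{G(x, z) − G(y, z)}. (3.62)
Proposition 3.7. For x, y, z ∈ T_η, 0 < α < 1, and all 0 ≤ j ≤ k − 1, |G^η_{(j)}(x, y)|, … (3.63) … |(∂_α(x, y)G^η_{(j)})(z)|,
|(∂_α(x, y)∂^ηG^η_{(j)})(z)| ≤ C{(L^jη)^{2−d−α}, (L^jη)^{1−d−α}}exp[−δ₀(L^jη)^{−1}dist({x, y}, z)] (3.65) … Proposition 3.7 follows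
immediately from Theorem 3.3 and the scaling properties of the operators."*; p. 665 [PDF 17] l. 22–23: *"We note that Proposition 3.7
also holds for G^η_{(j)}(Ω′) and G^η_{(j)}(Ω′, A^{(k)}), since Theorem 3.3 gives bounds on these operators also."*
T. Bałaban, *(Higgs)₂,₃ quantum fields in a finite volume III*, Commun. Math. Phys. **88** (1983) 411–445 [Balaban1983Higgs3], (2.10)–(2.11)
p. 426: the same bounds for the pieces `G^η_{(j)}(Ω, B̃)` of (I.2.43) at a regular background `B̃`, the Hölder line WITH the transport
`U(B̃(Γ_{x₁,x₂}))` — PROVED in the tree on `Ω = T_η` by lit-balaban p26 (`B3Ineq210RegularTorus.ineq210_regularTorus`,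
`B3Ineq211RegularTorus.ineq211At_regularTorus`) for the carrier `regTorusKernelsH S C A m² a k` (kernels read as the column-sum norm
`ε^{−d}Σ_{i′}‖(G^η_{(j)}e_{(x′,i′)})(x)‖` of the `N × N` block; covariant derivative (I.1.7) in the row variable).

## What this file proves (0 `def`, 0 `sorry`; nothing of p26 re-proved — its displays enter as HYPOTHESES `Ineq210 δ C`, `Ineq211At α δ C`)

King's (3.62) is TRANSPORT-FREE.  In the block-NORM reading of `|G(x, y)|` (p26's; the rung's g21 reading of King's Thm 3.3 `|X(x,y)|`)
the transport is IMMATERIAL, because `U(A(Γ))` is an isometry: `|‖X(x,z)‖ − ‖X(y,z)‖| ≤ ‖U(A(Γ))X(x,z) − X(y,z)‖`, and one plain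
lattice step costs `|‖φ(x + εe_μ)‖ − ‖φ(x)‖| ≤ ε‖(D^ε_Aφ)(⟨x,μ⟩)‖`.  Hence, on p26's carriers:
* §1 `abs_norm_sub_norm_le_hol`, `abs_norm_shift_sub_norm_le` (the two isometry letters); `absG_nonneg`, `absDG_nonneg`;
  `absG_step_le` (one bond), `absG_chain_le` (telescoping along a torus chain).
* §2 ★ `absG_holder_near` (pairs with `ε|x − y| ≤ L^jε`: (2.10)'s derivative member chained along an admissible staircase `|Γ| ≤ d|x − y|`,
  `exists_isAdm`), ★ `absG_holder_far` (pairs with `L^jε ≤ ε|x − y|`: sizes), ★★ **`absG_holder_le`** — (3.65)₁ transport-free, ALL pairs: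
  `|absG j x z − absG j y z| ≤ (d·e^{δd} + 2)·C·(ε|x − y|)^α(L^jε)^{2−d−α}e^{−δ(L^jε)^{−1}ε·min(|x − z|,|y − z|)}` under `Ineq210 δ C`.
* §3 ★★ **`absDG_holder_le`** — (3.65)₂ transport-free from (2.11) VERBATIM: `|absDG j μ x z − absDG j μ y z| ≤ holderTerm(Γ) ≤ holderDiff`
  (`holderTerm_le_holderDiff`) `≤ C(ε|x − y|)^α(L^jε)^{1−d−α}e^{−δ(L^jε)^{−1}dist({x,y},z)}` under `Ineq211At α δ C`.
Units are p26's (`ε`-units: `dist = ε|x − y|`, `scale j = L^jε`); the sequel file rescales to King's `η = L^{−k}` units and inhabits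
`King1986.SlicePropagator.Prop37PrintedAt` ∕ `Prop37KingOrder` BY NAME.

HONEST SCOPE.  `|G(x,y)|` and the Hölder quotient (3.62) are READ on the gauge-INVARIANT block norm `x ↦ |G^η_{(j)}(x, z)|`; the entrywise
transport-free differences `G(x,z)_{ii′} − G(y,z)_{ii′}` are gauge-VARIANT and would need King's re-gauging (3.43)–(3.46) (|Ã^{(k)}(x)| ≤ Cp(L^kε)|x − x₀|,
(3.45)) — NOT claimed here.  `Ω = T_ε` only; constants those of the hypotheses.  Unit `pub-ymgap-dag-n15-e` g22 (R141 (C) s3), PART Ζ-a.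
-/

noncomputable section

open scoped BigOperators

namespace Summit.QuantumFields.YangMills.BalabanUVNodes.N15KingModelRung.RegularField

open Literature.MathematicalPhysics.QuantumFieldTheory.Balaban1983to89
open Literature.MathematicalPhysics.QuantumFieldTheory.Balaban1983to89.HiggsLattice (ChargeData ScalarField covDeriv)
open Literature.MathematicalPhysics.QuantumFieldTheory.Balaban1983to89.B1Eq230FluctCov (Ix cb)
open Literature.MathematicalPhysics.QuantumFieldTheory.Balaban1983to89.B1Ineq234LevelZero (tdist_comm tdist_triangle_real tdist_shift_le_one)
open Literature.MathematicalPhysics.QuantumFieldTheory.Balaban1983to89.B1TorusChainTransport (IsTChain TNbr hol norm_hol_apply tdist_mem_chain_le)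
open Literature.MathematicalPhysics.QuantumFieldTheory.Balaban1983to89.B2Restr216Lattice (norm_U_apply)
open Literature.MathematicalPhysics.QuantumFieldTheory.Balaban1983to89.B4GaugeCovariance (pathEnd)
open Literature.MathematicalPhysics.QuantumFieldTheory.Balaban1983to89.B3Sect2StatementsPart2 (ScaledKernels)
open Literature.MathematicalPhysics.QuantumFieldTheory.Balaban1983to89.B1Eq211ZeroFieldTorus (Shape)
open Literature.MathematicalPhysics.QuantumFieldTheory.Balaban1983to89.B3Ineq210RegularTorus (pieceA regTorusKernels regTorusKernels_absG
  regTorusKernels_absDG regTorusKernels_dist scale_eq mesh_eq_pow_mul)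
open Literature.MathematicalPhysics.QuantumFieldTheory.Balaban1983to89.B3Ineq211RegularTorus (IsAdm exists_isAdm one_le_tdist_of_ne' holderTerm
  holderTerm_le_holderDiff regTorusKernelsH scaleH_eq)

variable {P : HiggsLattice.Params} {N : ℕ}

/-! ## §1 Isometry letters; the one-bond step and the chain telescoping of the block-norm kernel -/

/-- **Transports are immaterial for norms**: `|‖v‖ − ‖w‖| ≤ ‖U(A(Γ))v − w‖` (`U(A(Γ))` is an isometry). [cite: Balaban1982Higgs1, (1.7) p.605] -/
theorem abs_norm_sub_norm_le_hol {k : ℕ} (C : ChargeData N) (A : HiggsLattice.VecField P k) (x : HiggsLattice.Site P k)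
    (l : List (HiggsLattice.Site P k)) (v w : EuclideanSpace ℝ (Fin N)) : |‖v‖ - ‖w‖| ≤ ‖hol C A x l v - w‖ := by
  rw [← norm_hol_apply C A x l v]
  exact abs_norm_sub_norm_le _ _

/-- **One plain lattice step costs one covariant derivative, in norm**: `|‖φ(x + εe_μ)‖ − ‖φ(x)‖| ≤ (L^kε)·‖(D_Aφ)(⟨x, μ⟩)‖`
(`U(A_b)` is an isometry and `U(A_b)φ(b₊) − φ(b₋) = (L^kε)·(D_Aφ)(b)`, (1.7)). [cite: Balaban1982Higgs1, (1.7) p.605] [cite: King1986, (3.62) p.663] -/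
theorem abs_norm_shift_sub_norm_le {k : ℕ} (C : ChargeData N) (A : HiggsLattice.VecField P k) (φ : ScalarField P k N)
    (x : HiggsLattice.Site P k) (μ : Fin P.d) :
    |‖φ (x.shift μ)‖ - ‖φ x‖| ≤ P.mesh k * ‖covDeriv C A φ ⟨x, μ⟩‖ := by
  have hmesh : 0 < P.mesh k := P.mesh_pos k
  have hid : C.U (P.mesh k) (A ⟨x, μ⟩) (φ (x.shift μ)) - φ x = P.mesh k • covDeriv C A φ ⟨x, μ⟩ := by
    unfold covDeriv
    rw [smul_smul, mul_inv_cancel₀ hmesh.ne', one_smul]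
    rfl
  calc |‖φ (x.shift μ)‖ - ‖φ x‖| = |‖C.U (P.mesh k) (A ⟨x, μ⟩) (φ (x.shift μ))‖ - ‖φ x‖| := by rw [norm_U_apply]
    _ ≤ ‖C.U (P.mesh k) (A ⟨x, μ⟩) (φ (x.shift μ)) - φ x‖ := abs_norm_sub_norm_le _ _
    _ = P.mesh k * ‖covDeriv C A φ ⟨x, μ⟩‖ := by rw [hid, norm_smul, Real.norm_of_nonneg hmesh.le]

section Torus

variable {S : Shape P} {C : ChargeData N} {A : HiggsLattice.VecField P 0} {msq a : ℝ} {k : ℕ}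

/-- the block-norm kernel `|G^η_{(j)}(x, x′)|` of p26's carrier is non-negative. [cite: Balaban1983Higgs3, (2.10) p.426] -/
theorem absG_nonneg (j : ℕ) (x x' : HiggsLattice.Site P 0) : 0 ≤ (regTorusKernels S C A msq a k).absG j x x' := by
  rw [regTorusKernels_absG]
  exact mul_nonneg (inv_nonneg.2 (pow_nonneg (P.mesh_pos 0).le _)) (Finset.sum_nonneg fun _ _ => norm_nonneg _)

/-- the block-norm derivative kernel `|(D_{A,μ}G^η_{(j)})(x, x′)|` is non-negative. [cite: Balaban1983Higgs3, (2.10) p.426] -/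
theorem absDG_nonneg (j : ℕ) (μ : Fin P.d) (x x' : HiggsLattice.Site P 0) : 0 ≤ (regTorusKernels S C A msq a k).absDG j μ x x' := by
  rw [regTorusKernels_absDG]
  exact mul_nonneg (inv_nonneg.2 (pow_nonneg (P.mesh_pos 0).le _)) (Finset.sum_nonneg fun _ _ => norm_nonneg _)

/-- **THE ONE-BOND STEP**: `||G^η_{(j)}(x + εe_μ, z)| − |G^η_{(j)}(x, z)|| ≤ ε·|(D_{A,μ}G^η_{(j)})(x, z)|` — King's plain difference (3.62) of the
block-norm kernel over one bond is one covariant derivative (the link variable is an isometry). [cite: King1986, (3.62) p.663] [cite: Balaban1983Higgs3, (2.10) p.426] -/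
theorem absG_step_le (j : ℕ) (x z : HiggsLattice.Site P 0) (μ : Fin P.d) :
    |(regTorusKernels S C A msq a k).absG j (x.shift μ) z - (regTorusKernels S C A msq a k).absG j x z|
      ≤ P.mesh 0 * (regTorusKernels S C A msq a k).absDG j μ x z := by
  rw [regTorusKernels_absG, regTorusKernels_absG, regTorusKernels_absDG, ← mul_sub, abs_mul,
    abs_of_nonneg (inv_nonneg.2 (pow_nonneg (P.mesh_pos 0).le _)), ← Finset.sum_sub_distrib, mul_left_comm]
  refine mul_le_mul_of_nonneg_left ?_ (inv_nonneg.2 (pow_nonneg (P.mesh_pos 0).le _))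
  rw [Finset.mul_sum]
  exact (Finset.abs_sum_le_sum_abs _ _).trans (Finset.sum_le_sum fun i' _ => abs_norm_shift_sub_norm_le C A _ x μ)

/-- **CHAIN TELESCOPING**: along a nearest-neighbour chain `y, l₀, …, l_{n−1}` on `T_ε`, if every site `w` of the chain has
`ε·|(D_{A,μ}G^η_{(j)})(w, z)| ≤ M` for all `μ`, then `||G^η_{(j)}(end, z)| − |G^η_{(j)}(y, z)|| ≤ n·M`. [cite: King1986, (3.62) p.663] [cite: Balaban1982Higgs1, (1.3) p.604] -/
theorem absG_chain_le (j : ℕ) (z : HiggsLattice.Site P 0) {M : ℝ} :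
    ∀ (y : HiggsLattice.Site P 0) (l : List (HiggsLattice.Site P 0)), IsTChain y l →
      (∀ w ∈ y :: l, ∀ μ : Fin P.d, P.mesh 0 * (regTorusKernels S C A msq a k).absDG j μ w z ≤ M) →
      |(regTorusKernels S C A msq a k).absG j (pathEnd y l) z - (regTorusKernels S C A msq a k).absG j y z| ≤ l.length * M := by
  intro y l
  induction l generalizing y with
  | nil =>
      intro _ _
      simp [pathEnd]
  | cons w l ih =>
      intro hch hM
      obtain ⟨⟨μ, hμ⟩, hl⟩ := hch
      have hM' : ∀ w' ∈ w :: l, ∀ μ : Fin P.d, P.mesh 0 * (regTorusKernels S C A msq a k).absDG j μ w' z ≤ M :=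
        fun w' hw' μ => hM w' (List.mem_cons_of_mem _ hw') μ
      have hrest := ih w hl hM'
      have hstep : |(regTorusKernels S C A msq a k).absG j w z - (regTorusKernels S C A msq a k).absG j y z| ≤ M := by
        rcases hμ with rfl | rfl
        · exact (absG_step_le j y z μ).trans (hM y List.mem_cons_self μ)
        · rw [abs_sub_comm]
          exact (absG_step_le j w z μ).trans (hM w (List.mem_cons_of_mem _ List.mem_cons_self) μ)
      simp only [pathEnd, List.length_cons, Nat.cast_succ]
      have hM0 : 0 ≤ M := le_trans (by positivity) hstep
      calc |(regTorusKernels S C A msq a k).absG j (pathEnd w l) z - (regTorusKernels S C A msq a k).absG j y z|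
          ≤ |(regTorusKernels S C A msq a k).absG j (pathEnd w l) z - (regTorusKernels S C A msq a k).absG j w z|
              + |(regTorusKernels S C A msq a k).absG j w z - (regTorusKernels S C A msq a k).absG j y z| := abs_sub_le _ _ _
        _ ≤ l.length * M + M := add_le_add hrest hstep
        _ = (l.length + 1) * M := by ring

/-- `absG_chain_le` with the end point named: `pathEnd y l = x`. [cite: King1986, (3.62) p.663] [cite: Balaban1982Higgs1, (1.3) p.604] -/
theorem absG_chain_le' (j : ℕ) (z : HiggsLattice.Site P 0) {M : ℝ} (y : HiggsLattice.Site P 0) (l : List (HiggsLattice.Site P 0))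
    (hch : IsTChain y l) {x : HiggsLattice.Site P 0} (hend : pathEnd y l = x)
    (hM : ∀ w ∈ y :: l, ∀ μ : Fin P.d, P.mesh 0 * (regTorusKernels S C A msq a k).absDG j μ w z ≤ M) :
    |(regTorusKernels S C A msq a k).absG j x z - (regTorusKernels S C A msq a k).absG j y z| ≤ l.length * M := by
  subst hend
  exact absG_chain_le j z y l hch hM

/-! ## §2 (3.65)₁ transport-free for the block-norm kernel, from (2.10) -/

/-- exponential weights with a shifted argument: `e^{−ρ(t − u)} = e^{−ρt}·e^{ρu}`. [folklore] -/
private theorem exp_neg_mul_sub (ρ t u : ℝ) : Real.exp (-(ρ * (t - u))) = Real.exp (-(ρ * t)) * Real.exp (ρ * u) := by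
  rw [← Real.exp_add]; congr 1; ring

/-- ★ **(3.65)₁ FOR NEAR PAIRS** (`ε|x − y| ≤ L^jε`): under (2.10) at constants `(δ, Cst)`,
`||G^η_{(j)}(x,z)| − |G^η_{(j)}(y,z)|| ≤ d·Cst·e^{δd}·(ε|x − y|)^α(L^jε)^{2−d−α}e^{−δ(L^jε)^{−1}ε·min(|x − z|,|y − z|)}` — the derivative member of (2.10)
chained along p26's admissible staircase from `y` to `x` (`|Γ| ≤ d|x − y|`, all of it within `d|x − y| ≤ dL^j` lattice steps of `y`).
[cite: King1986, Prop 3.7 (3.65) p.663] [cite: Balaban1983Higgs3, (2.10) p.426] -/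
theorem absG_holder_near {δ Cst : ℝ} (hδ : 0 ≤ δ) (hCst : 0 ≤ Cst) (h210 : (regTorusKernels S C A msq a k).Ineq210 δ Cst)
    {α : ℝ} (hα1 : α ≤ 1) (j : ℕ) {x y : HiggsLattice.Site P 0} (hxy : x ≠ y)
    (hnear : P.mesh 0 * (HiggsLattice.Site.tdist x y : ℝ) ≤ P.mesh j) (z : HiggsLattice.Site P 0) :
    |(regTorusKernels S C A msq a k).absG j x z - (regTorusKernels S C A msq a k).absG j y z|
      ≤ (P.d : ℝ) * Cst * Real.exp (δ * P.d) * (P.mesh 0 * (HiggsLattice.Site.tdist x y : ℝ)) ^ α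
          * P.mesh j ^ ((2 : ℝ) - (P.d : ℝ) - α)
          * Real.exp (-(δ * (P.mesh j)⁻¹ * (P.mesh 0 * min (HiggsLattice.Site.tdist x z : ℝ) (HiggsLattice.Site.tdist y z : ℝ)))) := by
  have hε : 0 < P.mesh 0 := P.mesh_pos 0
  have hs : 0 < P.mesh j := P.mesh_pos j
  obtain ⟨Γ, hch, hend, hlen⟩ := exists_isAdm y x
  -- the uniform bound on the chain sites
  set r : ℝ := P.mesh 0 * (HiggsLattice.Site.tdist x y : ℝ) with hr
  have hr0 : 0 < r := by
    have h1 : (1 : ℝ) ≤ HiggsLattice.Site.tdist x y := by exact_mod_cast one_le_tdist_of_ne' (Ne.symm hxy)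
    rw [hr]; positivity
  have htxy : (HiggsLattice.Site.tdist y x : ℝ) = HiggsLattice.Site.tdist x y := by rw [tdist_comm]
  set Emin : ℝ := Real.exp (-(δ * (P.mesh j)⁻¹ * (P.mesh 0 * min (HiggsLattice.Site.tdist x z : ℝ) (HiggsLattice.Site.tdist y z : ℝ))))
    with hEmin
  set M : ℝ := P.mesh 0 * (Cst * P.mesh j ^ ((1 : ℝ) - (P.d : ℝ)) * (Emin * Real.exp (δ * P.d))) with hM
  have hchain : ∀ w ∈ y :: Γ, ∀ μ : Fin P.d, P.mesh 0 * (regTorusKernels S C A msq a k).absDG j μ w z ≤ M := by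
    intro w hw μ
    have hb := ((h210 j w z).2 μ)
    rw [scale_eq, regTorusKernels_dist] at hb
    -- `|w − z| ≥ |y − z| − |y − w| ≥ min(|x−z|,|y−z|) − d|x − y|`, and `ε·d|x − y| ≤ d·L^jε`
    have hyw : (HiggsLattice.Site.tdist y w : ℝ) ≤ Γ.length := tdist_mem_chain_le hch w hw
    have hlen' : (Γ.length : ℝ) ≤ (P.d : ℝ) * HiggsLattice.Site.tdist x y := by rw [← htxy]; exact hlen
    have htri : (HiggsLattice.Site.tdist y z : ℝ) ≤ HiggsLattice.Site.tdist y w + HiggsLattice.Site.tdist w z := tdist_triangle_real y w z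
    have hmin : min (HiggsLattice.Site.tdist x z : ℝ) (HiggsLattice.Site.tdist y z : ℝ) ≤ HiggsLattice.Site.tdist y z := min_le_right _ _
    have hwz : min (HiggsLattice.Site.tdist x z : ℝ) (HiggsLattice.Site.tdist y z : ℝ) - (P.d : ℝ) * HiggsLattice.Site.tdist x y
        ≤ (HiggsLattice.Site.tdist w z : ℝ) := by linarith
    have hexp : Real.exp (-(δ * (P.mesh j)⁻¹ * (P.mesh 0 * (HiggsLattice.Site.tdist w z : ℝ)))) ≤ Emin * Real.exp (δ * P.d) := by
      have hρ : 0 ≤ δ * (P.mesh j)⁻¹ * P.mesh 0 := by positivity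
      calc Real.exp (-(δ * (P.mesh j)⁻¹ * (P.mesh 0 * (HiggsLattice.Site.tdist w z : ℝ))))
          ≤ Real.exp (-(δ * (P.mesh j)⁻¹ * (P.mesh 0 *
              (min (HiggsLattice.Site.tdist x z : ℝ) (HiggsLattice.Site.tdist y z : ℝ) - (P.d : ℝ) * HiggsLattice.Site.tdist x y)))) := by
            rw [Real.exp_le_exp, neg_le_neg_iff, ← mul_assoc, ← mul_assoc]
            exact mul_le_mul_of_nonneg_left hwz hρ
        _ = Emin * Real.exp (δ * (P.mesh j)⁻¹ * ((P.d : ℝ) * r)) := by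
            rw [hEmin, hr, mul_sub, ← exp_neg_mul_sub]; congr 1; ring
        _ ≤ Emin * Real.exp (δ * P.d) := by
            refine mul_le_mul_of_nonneg_left (Real.exp_le_exp.2 ?_) (Real.exp_nonneg _)
            have h1 : (P.mesh j)⁻¹ * r ≤ 1 := by rw [inv_mul_le_iff₀ hs]; simpa [hr] using hnear
            have hd0 : (0 : ℝ) ≤ P.d := Nat.cast_nonneg _
            calc δ * (P.mesh j)⁻¹ * ((P.d : ℝ) * r) = δ * P.d * ((P.mesh j)⁻¹ * r) := by ring
              _ ≤ δ * P.d * 1 := mul_le_mul_of_nonneg_left h1 (mul_nonneg hδ hd0)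
              _ = δ * P.d := mul_one _
    calc P.mesh 0 * (regTorusKernels S C A msq a k).absDG j μ w z
        ≤ P.mesh 0 * (Cst * P.mesh j ^ ((1 : ℝ) - (P.d : ℝ)) * Real.exp (-(δ * (P.mesh j)⁻¹ * (P.mesh 0 * (HiggsLattice.Site.tdist w z : ℝ))))) :=
          mul_le_mul_of_nonneg_left hb hε.le
      _ ≤ M := by
          rw [hM]
          exact mul_le_mul_of_nonneg_left (mul_le_mul_of_nonneg_left hexp (by positivity)) hε.le
  have hmain := absG_chain_le' (S := S) (C := C) (A := A) (msq := msq) (a := a) (k := k) j z y Γ hch hend hchain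
  -- `|Γ|·M ≤ d|x−y|·M`, and `ε·d|x − y|·(L^jε)^{1−d} ≤ d·r^α(L^jε)^{2−d−α}` since `r ≤ L^jε`
  have hM0 : 0 ≤ M := by rw [hM]; positivity
  have hlen' : (Γ.length : ℝ) ≤ (P.d : ℝ) * HiggsLattice.Site.tdist x y := by rw [← htxy]; exact hlen
  refine hmain.trans ((mul_le_mul_of_nonneg_right hlen' hM0).trans ?_)
  have hkey : r * P.mesh j ^ ((1 : ℝ) - (P.d : ℝ)) ≤ r ^ α * P.mesh j ^ ((2 : ℝ) - (P.d : ℝ) - α) := by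
    have hrle : r ≤ P.mesh j := by simpa [hr] using hnear
    have h1 : r = r ^ α * r ^ (1 - α) := by
      rw [← Real.rpow_add hr0]; norm_num
    have h2 : r ^ (1 - α) ≤ P.mesh j ^ (1 - α) := Real.rpow_le_rpow hr0.le hrle (by linarith)
    have h3 : P.mesh j ^ (1 - α) * P.mesh j ^ ((1 : ℝ) - (P.d : ℝ)) = P.mesh j ^ ((2 : ℝ) - (P.d : ℝ) - α) := by
      rw [← Real.rpow_add hs]; congr 1; ring
    calc r * P.mesh j ^ ((1 : ℝ) - (P.d : ℝ)) = r ^ α * (r ^ (1 - α) * P.mesh j ^ ((1 : ℝ) - (P.d : ℝ))) := by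
          rw [← mul_assoc, ← h1]
      _ ≤ r ^ α * (P.mesh j ^ (1 - α) * P.mesh j ^ ((1 : ℝ) - (P.d : ℝ))) :=
          mul_le_mul_of_nonneg_left (mul_le_mul_of_nonneg_right h2 (Real.rpow_nonneg hs.le _)) (Real.rpow_nonneg hr0.le _)
      _ = r ^ α * P.mesh j ^ ((2 : ℝ) - (P.d : ℝ) - α) := by rw [h3]
  have hd0 : (0 : ℝ) ≤ P.d := Nat.cast_nonneg _
  calc (P.d : ℝ) * (HiggsLattice.Site.tdist x y : ℝ) * M
      = (P.d : ℝ) * Cst * Real.exp (δ * P.d) * (r * P.mesh j ^ ((1 : ℝ) - (P.d : ℝ))) * Emin := by rw [hM, hr]; ring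
    _ ≤ (P.d : ℝ) * Cst * Real.exp (δ * P.d) * (r ^ α * P.mesh j ^ ((2 : ℝ) - (P.d : ℝ) - α)) * Emin :=
        mul_le_mul_of_nonneg_right (mul_le_mul_of_nonneg_left hkey (by positivity)) (Real.exp_nonneg _)
    _ = (P.d : ℝ) * Cst * Real.exp (δ * P.d) * r ^ α * P.mesh j ^ ((2 : ℝ) - (P.d : ℝ) - α) * Emin := by ring

/-- ★ **(3.65)₁ FOR FAR PAIRS** (`L^jε ≤ ε|x − y|`): by sizes, `||G(x,z)| − |G(y,z)|| ≤ |G(x,z)| + |G(y,z)| ≤ 2·Cst·(ε|x − y|)^α(L^jε)^{2−d−α}e^{−δ(L^jε)^{−1}ε·min(|x−z|,|y−z|)}`.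
[cite: King1986, Prop 3.7 (3.65) p.663] [cite: Balaban1983Higgs3, (2.10) p.426] -/
theorem absG_holder_far {δ Cst : ℝ} (hδ : 0 ≤ δ) (hCst : 0 ≤ Cst) (h210 : (regTorusKernels S C A msq a k).Ineq210 δ Cst)
    {α : ℝ} (hα0 : 0 ≤ α) (j : ℕ) {x y : HiggsLattice.Site P 0}
    (hfar : P.mesh j ≤ P.mesh 0 * (HiggsLattice.Site.tdist x y : ℝ)) (z : HiggsLattice.Site P 0) :
    |(regTorusKernels S C A msq a k).absG j x z - (regTorusKernels S C A msq a k).absG j y z|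
      ≤ 2 * Cst * (P.mesh 0 * (HiggsLattice.Site.tdist x y : ℝ)) ^ α * P.mesh j ^ ((2 : ℝ) - (P.d : ℝ) - α)
          * Real.exp (-(δ * (P.mesh j)⁻¹ * (P.mesh 0 * min (HiggsLattice.Site.tdist x z : ℝ) (HiggsLattice.Site.tdist y z : ℝ)))) := by
  have hε : 0 < P.mesh 0 := P.mesh_pos 0
  have hs : 0 < P.mesh j := P.mesh_pos j
  set r : ℝ := P.mesh 0 * (HiggsLattice.Site.tdist x y : ℝ) with hr
  set m : ℝ := min (HiggsLattice.Site.tdist x z : ℝ) (HiggsLattice.Site.tdist y z : ℝ) with hm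
  have hx := (h210 j x z).1
  have hy := (h210 j y z).1
  rw [scale_eq, regTorusKernels_dist] at hx hy
  have hρ : 0 ≤ δ * (P.mesh j)⁻¹ * P.mesh 0 := by positivity
  have hex : Real.exp (-(δ * (P.mesh j)⁻¹ * (P.mesh 0 * (HiggsLattice.Site.tdist x z : ℝ)))) ≤ Real.exp (-(δ * (P.mesh j)⁻¹ * (P.mesh 0 * m))) := by
    rw [Real.exp_le_exp, neg_le_neg_iff, ← mul_assoc, ← mul_assoc]
    exact mul_le_mul_of_nonneg_left (min_le_left _ _) hρ
  have hey : Real.exp (-(δ * (P.mesh j)⁻¹ * (P.mesh 0 * (HiggsLattice.Site.tdist y z : ℝ)))) ≤ Real.exp (-(δ * (P.mesh j)⁻¹ * (P.mesh 0 * m))) := by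
    rw [Real.exp_le_exp, neg_le_neg_iff, ← mul_assoc, ← mul_assoc]
    exact mul_le_mul_of_nonneg_left (min_le_right _ _) hρ
  have hsize : P.mesh j ^ ((2 : ℝ) - (P.d : ℝ)) ≤ r ^ α * P.mesh j ^ ((2 : ℝ) - (P.d : ℝ) - α) := by
    have h1 : P.mesh j ^ ((2 : ℝ) - (P.d : ℝ)) = P.mesh j ^ α * P.mesh j ^ ((2 : ℝ) - (P.d : ℝ) - α) := by
      rw [← Real.rpow_add hs]; congr 1; ring
    rw [h1]
    exact mul_le_mul_of_nonneg_right (Real.rpow_le_rpow hs.le hfar hα0) (Real.rpow_nonneg hs.le _)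
  have hG0x := absG_nonneg (S := S) (C := C) (A := A) (msq := msq) (a := a) (k := k) j x z
  have hG0y := absG_nonneg (S := S) (C := C) (A := A) (msq := msq) (a := a) (k := k) j y z
  calc |(regTorusKernels S C A msq a k).absG j x z - (regTorusKernels S C A msq a k).absG j y z|
      ≤ (regTorusKernels S C A msq a k).absG j x z + (regTorusKernels S C A msq a k).absG j y z := by
        rw [abs_le]; constructor <;> linarith
    _ ≤ Cst * P.mesh j ^ ((2 : ℝ) - (P.d : ℝ)) * Real.exp (-(δ * (P.mesh j)⁻¹ * (P.mesh 0 * m)))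
        + Cst * P.mesh j ^ ((2 : ℝ) - (P.d : ℝ)) * Real.exp (-(δ * (P.mesh j)⁻¹ * (P.mesh 0 * m))) :=
        add_le_add (hx.trans (mul_le_mul_of_nonneg_left hex (by positivity))) (hy.trans (mul_le_mul_of_nonneg_left hey (by positivity)))
    _ = 2 * Cst * P.mesh j ^ ((2 : ℝ) - (P.d : ℝ)) * Real.exp (-(δ * (P.mesh j)⁻¹ * (P.mesh 0 * m))) := by ring
    _ ≤ 2 * Cst * (r ^ α * P.mesh j ^ ((2 : ℝ) - (P.d : ℝ) - α)) * Real.exp (-(δ * (P.mesh j)⁻¹ * (P.mesh 0 * m))) :=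
        mul_le_mul_of_nonneg_right (mul_le_mul_of_nonneg_left hsize (by positivity)) (Real.exp_nonneg _)
    _ = 2 * Cst * r ^ α * P.mesh j ^ ((2 : ℝ) - (P.d : ℝ) - α) * Real.exp (-(δ * (P.mesh j)⁻¹ * (P.mesh 0 * m))) := by ring

/-- ★★ **(3.65)₁ TRANSPORT-FREE AT A REGULAR BACKGROUND, ALL PAIRS**: under (2.10) at `(δ, Cst)`, for `0 ≤ α ≤ 1`, every slice `j`, all `x ≠ y`, `z`:
`||G^η_{(j)}(x,z)| − |G^η_{(j)}(y,z)|| ≤ (d·e^{δd} + 2)·Cst·(ε|x − y|)^α(L^jε)^{2−d−α}e^{−δ(L^jε)^{−1}dist({x,y},z)}` — King's (3.65)₁ for the block-norm kernel,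
with `dist({x,y},z) = ε·min(|x − z|, |y − z|)`. [cite: King1986, Prop 3.7 (3.62), (3.65) p.663, p.665 «also holds for G_(j)(Ω′, A^{(k)})»] [cite: Balaban1983Higgs3, (2.10) p.426] -/
theorem absG_holder_le {δ Cst : ℝ} (hδ : 0 ≤ δ) (hCst : 0 ≤ Cst) (h210 : (regTorusKernels S C A msq a k).Ineq210 δ Cst)
    {α : ℝ} (hα0 : 0 ≤ α) (hα1 : α ≤ 1) (j : ℕ) {x y : HiggsLattice.Site P 0} (hxy : x ≠ y) (z : HiggsLattice.Site P 0) :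
    |(regTorusKernels S C A msq a k).absG j x z - (regTorusKernels S C A msq a k).absG j y z|
      ≤ ((P.d : ℝ) * Real.exp (δ * P.d) + 2) * Cst * (P.mesh 0 * (HiggsLattice.Site.tdist x y : ℝ)) ^ α
          * P.mesh j ^ ((2 : ℝ) - (P.d : ℝ) - α)
          * Real.exp (-(δ * (P.mesh j)⁻¹ * (P.mesh 0 * min (HiggsLattice.Site.tdist x z : ℝ) (HiggsLattice.Site.tdist y z : ℝ)))) := by
  set W : ℝ := (P.mesh 0 * (HiggsLattice.Site.tdist x y : ℝ)) ^ α * P.mesh j ^ ((2 : ℝ) - (P.d : ℝ) - α)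
      * Real.exp (-(δ * (P.mesh j)⁻¹ * (P.mesh 0 * min (HiggsLattice.Site.tdist x z : ℝ) (HiggsLattice.Site.tdist y z : ℝ)))) with hW
  have hW0 : 0 ≤ W := by
    rw [hW]
    exact mul_nonneg (mul_nonneg (Real.rpow_nonneg (mul_nonneg (P.mesh_pos 0).le (Nat.cast_nonneg _)) _)
      (Real.rpow_nonneg (P.mesh_pos j).le _)) (Real.exp_nonneg _)
  have hgoal : ((P.d : ℝ) * Real.exp (δ * P.d) + 2) * Cst * (P.mesh 0 * (HiggsLattice.Site.tdist x y : ℝ)) ^ α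
        * P.mesh j ^ ((2 : ℝ) - (P.d : ℝ) - α)
        * Real.exp (-(δ * (P.mesh j)⁻¹ * (P.mesh 0 * min (HiggsLattice.Site.tdist x z : ℝ) (HiggsLattice.Site.tdist y z : ℝ))))
      = (P.d : ℝ) * Cst * Real.exp (δ * P.d) * W + 2 * Cst * W := by rw [hW]; ring
  rw [hgoal]
  rcases le_total (P.mesh 0 * (HiggsLattice.Site.tdist x y : ℝ)) (P.mesh j) with hnear | hfar
  · have h := absG_holder_near hδ hCst h210 hα1 j hxy hnear z
    have h' : |(regTorusKernels S C A msq a k).absG j x z - (regTorusKernels S C A msq a k).absG j y z|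
        ≤ (P.d : ℝ) * Cst * Real.exp (δ * P.d) * W := by rw [hW]; simpa [mul_assoc] using h
    exact h'.trans (le_add_of_nonneg_right (by positivity))
  · have h := absG_holder_far hδ hCst h210 hα0 j hfar z
    have h' : |(regTorusKernels S C A msq a k).absG j x z - (regTorusKernels S C A msq a k).absG j y z| ≤ 2 * Cst * W := by
      rw [hW]; simpa [mul_assoc] using h
    exact h'.trans (le_add_of_nonneg_left (by positivity))

/-! ## §3 (3.65)₂ transport-free for the block-norm derivative kernel, from (2.11) verbatim -/

/-- **The transport drops out of the norm reading**: for every contour `Γ` from `y`,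
`||(D_{A,μ}G^η_{(j)})(x,z)| − |(D_{A,μ}G^η_{(j)})(y,z)|| ≤ holderTerm(Γ)` (= `ε^{−d}Σ_{i′}‖U(A(Γ))(D Ge)(x) − (D Ge)(y)‖`, p26's transported
Hölder term with `x₁ = y`, `x₂ = x`). [cite: King1986, (3.62) p.663] [cite: Balaban1983Higgs3, (2.11) p.426] -/
theorem abs_absDG_sub_le_holderTerm (j : ℕ) (μ : Fin P.d) (x y z : HiggsLattice.Site P 0) (Γ : List (HiggsLattice.Site P 0)) :
    |(regTorusKernels S C A msq a k).absDG j μ x z - (regTorusKernels S C A msq a k).absDG j μ y z|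
      ≤ holderTerm C A msq a k j μ y x z Γ := by
  rw [regTorusKernels_absDG, regTorusKernels_absDG, holderTerm, ← mul_sub, abs_mul,
    abs_of_nonneg (inv_nonneg.2 (pow_nonneg (P.mesh_pos 0).le _)), ← Finset.sum_sub_distrib]
  refine mul_le_mul_of_nonneg_left ?_ (inv_nonneg.2 (pow_nonneg (P.mesh_pos 0).le _))
  exact (Finset.abs_sum_le_sum_abs _ _).trans (Finset.sum_le_sum fun i' _ => abs_norm_sub_norm_le_hol C A y Γ _ _)

/-- ★★ **(3.65)₂ TRANSPORT-FREE AT A REGULAR BACKGROUND, FROM (2.11) VERBATIM**: under `Ineq211At α δ Cst` for p26's Hölder carrier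
`regTorusKernelsH S C A m² a k`, for all `x ≠ y`, `z`, `μ`, `j`:
`||(D_{A,μ}G^η_{(j)})(x,z)| − |(D_{A,μ}G^η_{(j)})(y,z)|| ≤ Cst·(ε|x − y|)^α(L^jε)^{1−d−α}e^{−δ(L^jε)^{−1}ε·min(|x − z|,|y − z|)}` — the block norm turns
[Ba3]'s transported difference into King's plain one (`holderTerm_le_holderDiff` along an admissible contour, which exists: `exists_isAdm`).
[cite: King1986, Prop 3.7 (3.62), (3.65) p.663, p.665] [cite: Balaban1983Higgs3, (2.11) p.426] -/
theorem absDG_holder_le {α δ Cst : ℝ} (h211 : (regTorusKernelsH S C A msq a k).Ineq211At α δ Cst)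
    (j : ℕ) (μ : Fin P.d) {x y : HiggsLattice.Site P 0} (hxy : x ≠ y) (z : HiggsLattice.Site P 0) :
    |(regTorusKernels S C A msq a k).absDG j μ x z - (regTorusKernels S C A msq a k).absDG j μ y z|
      ≤ Cst * (P.mesh 0 * (HiggsLattice.Site.tdist x y : ℝ)) ^ α * P.mesh j ^ ((1 : ℝ) - (P.d : ℝ) - α)
          * Real.exp (-(δ * (P.mesh j)⁻¹ * (P.mesh 0 * min (HiggsLattice.Site.tdist x z : ℝ) (HiggsLattice.Site.tdist y z : ℝ)))) := by
  have hε : 0 < P.mesh 0 := P.mesh_pos 0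
  obtain ⟨Γ, hΓ⟩ := exists_isAdm y x
  have h1 := abs_absDG_sub_le_holderTerm (S := S) (C := C) (A := A) (msq := msq) (a := a) (k := k) j μ x y z Γ
  have h2 := holderTerm_le_holderDiff (S := S) (C := C) (A := A) (msq := msq) (a := a) (k := k) j μ y x z hΓ
  have h3 := h211 j μ y x z (Ne.symm hxy)
  -- unfold the carrier's fields in (2.11)
  have hdist : (regTorusKernelsH S C A msq a k).dist y x = P.mesh 0 * (HiggsLattice.Site.tdist x y : ℝ) := by
    show P.mesh 0 * (HiggsLattice.Site.tdist y x : ℝ) = _; rw [tdist_comm]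
  have hdist2 : (regTorusKernelsH S C A msq a k).dist2 y x z
      = P.mesh 0 * min (HiggsLattice.Site.tdist x z : ℝ) (HiggsLattice.Site.tdist y z : ℝ) := by
    show P.mesh 0 * min (HiggsLattice.Site.tdist y z : ℝ) (HiggsLattice.Site.tdist x z : ℝ) = _; rw [min_comm]
  have hd : ((regTorusKernelsH S C A msq a k).d : ℝ) = P.d := rfl
  rw [scaleH_eq, hdist, hdist2, hd] at h3
  have hr0 : 0 < P.mesh 0 * (HiggsLattice.Site.tdist x y : ℝ) := by
    have : (1 : ℝ) ≤ HiggsLattice.Site.tdist x y := by exact_mod_cast one_le_tdist_of_ne' (Ne.symm hxy)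
    positivity
  have hrα : 0 < (P.mesh 0 * (HiggsLattice.Site.tdist x y : ℝ)) ^ α := Real.rpow_pos_of_pos hr0 _
  rw [div_le_iff₀ hrα] at h3
  calc |(regTorusKernels S C A msq a k).absDG j μ x z - (regTorusKernels S C A msq a k).absDG j μ y z|
      ≤ (regTorusKernelsH S C A msq a k).holderDiff j μ y x z := h1.trans h2
    _ ≤ Cst * P.mesh j ^ ((1 : ℝ) - (P.d : ℝ) - α)
          * Real.exp (-(δ * (P.mesh j)⁻¹ * (P.mesh 0 * min (HiggsLattice.Site.tdist x z : ℝ) (HiggsLattice.Site.tdist y z : ℝ))))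
          * (P.mesh 0 * (HiggsLattice.Site.tdist x y : ℝ)) ^ α := h3
    _ = _ := by ring

end Torus

end Summit.QuantumFields.YangMills.BalabanUVNodes.N15KingModelRung.RegularField

end
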